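import Summits.MatrixMultiplication.MatrixMultiplication.Theorems.FidelityWitnessesLinearDefectLawFidelity
import Summits.MatrixMultiplication.MatrixMultiplication.Theorems.FidelityWitnessesFlatteningWitness
import Literature.Computability.AlgebraicComplexity.BorderRankMatMulThreeSmirnov
import Literature.Computability.AlgebraicComplexity.BorderRankMatMulTwoSeven
import Literature.Computability.AlgebraicComplexity.CoppersmithWinograd1982Crude

/-!
# `FidelityWitnesses.LinearDefectLaw` (stmt-MatrixMultiplication-14039) — the law OUTSIDE the window, unconditionally

`LinearDefectLaw` asserts, for `T = ⟨n,n,n⟩ = matMulTensor ℂ n n n` (`‖T‖² = n³`) and every `S` of rank `≤ r`,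
`|Σ S·T|² ≤ (n³ + r − R̲(T))·Σ‖S‖²`, with `R̲ = algBorderRank` never evaluated.  Two regimes are theorems for
every `n`, whatever the (unknown) value of `R̲(⟨n,n,n⟩)`:

* **high regime** `R̲ ≤ r` (`law_of_borderRank_le`): the coefficient is `≥ n³` and Cauchy–Schwarz
  (`LinearDefectLaw.Reduction.overlap_sq_le`) suffices; in particular `n³ ≤ r` (`law_of_cube_le`);
* **flattening regime** `r·n + U ≤ n³ + r` for ANY certified upper bound `U ≥ R̲(⟨n,n,n⟩)`
  (`law_of_flattening_regime`): the route support `FlatteningWitness` (stmt-4960, `M(n,r) ≤ n·r`,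
  `flatteningWitness_proof`) gives `n·r ≤ n³ + r − U ≤ n³ + r − R̲`.

With the tree's certificates `R̲(⟨3,3,3⟩) ≤ 20` (Smirnov) and `R̲(⟨4,4,4⟩) ≤ R̲(⟨2,2,2⟩)² ≤ 49`
(Kronecker square of Strassen) this settles the law unconditionally at `n = 3` for `r ≤ 3 ∨ 20 ≤ r`
(`lawAtThree_off_window`) and at `n = 4` for `r ≤ 5 ∨ 49 ≤ r` (`lawAtFour_off_window`); the open content of the
crux at `n = 3` is exactly the window `4 ≤ r ≤ 19` (at `n = 2` the sharper `lawAtTwo_off_window`,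
`r ≤ 3 ∨ 7 ≤ r`, is already in `…LinearDefectLawThreeDeficient`).  This is the "regime I by the plain
flattening" lemma of crux card `Cruxes/LinearDefectLaw/Ideas/metric-koszul-window.md`, recorded as the
registered stub `stub_lawOffWindow`.
-/

namespace Summit.MatrixMultiplication.MatrixMultiplication.Theorems.LinearDefectLaw.Regimes

open scoped BigOperators
open Literature.Computability.AlgebraicComplexity
open Summit.MatrixMultiplication.MatrixMultiplication.Theorems
open Summit.MatrixMultiplication.MatrixMultiplication.Theorems.LinearDefectLaw.Reduction (P overlap normSq
  overlap_sq_le normSq_nonneg)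

set_option linter.dupNamespace false

/-- **High regime** (`R̲(⟨n,n,n⟩) ≤ r`): the coefficient `n³ + r − R̲` is at least `n³`, so Cauchy–Schwarz
`|Σ S·T|² ≤ n³·Σ‖S‖²` gives the law at `(n, r)` for EVERY tensor `S` (no rank hypothesis). [folklore] -/
theorem law_of_borderRank_le {n r : ℕ} (hr : algBorderRank (matMulTensor ℂ n n n) ≤ r)
    (S : P n → P n → P n → ℂ) :
    ‖∑ a, ∑ b, ∑ c, S a b c * matMulTensor ℂ n n n a b c‖ ^ 2 ≤
      ((n : ℝ) ^ 3 + (r : ℝ) - (algBorderRank (matMulTensor ℂ n n n) : ℝ)) *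
        ∑ a, ∑ b, ∑ c, ‖S a b c‖ ^ 2 := by
  have h1 : ‖overlap S‖ ^ 2 ≤ (n : ℝ) ^ 3 * normSq S := overlap_sq_le S
  have h2 : (n : ℝ) ^ 3 ≤ (n : ℝ) ^ 3 + (r : ℝ) - (algBorderRank (matMulTensor ℂ n n n) : ℝ) := by
    have : (algBorderRank (matMulTensor ℂ n n n) : ℝ) ≤ r := by exact_mod_cast hr
    linarith
  exact h1.trans (mul_le_mul_of_nonneg_right h2 (normSq_nonneg S))

/-- **Above the cube** (`n³ ≤ r`): `R̲(⟨n,n,n⟩) ≤ R(⟨n,n,n⟩) ≤ n³ ≤ r`, so the high regime applies. [folklore] -/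
theorem law_of_cube_le {n r : ℕ} (hr : n ^ 3 ≤ r) (S : P n → P n → P n → ℂ) :
    ‖∑ a, ∑ b, ∑ c, S a b c * matMulTensor ℂ n n n a b c‖ ^ 2 ≤
      ((n : ℝ) ^ 3 + (r : ℝ) - (algBorderRank (matMulTensor ℂ n n n) : ℝ)) *
        ∑ a, ∑ b, ∑ c, ‖S a b c‖ ^ 2 := by
  refine law_of_borderRank_le ?_ S
  have h1 : algBorderRank (matMulTensor ℂ n n n) ≤ n * n * n :=
    (algBorderRank_le_tensorRank _).trans (tensorRank_matMulTensor_le (K := ℂ) n n n)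
  have h2 : n * n * n = n ^ 3 := by ring
  omega

/-- **Flattening regime** (`r·n + U ≤ n³ + r` for a certified `U ≥ R̲(⟨n,n,n⟩)`): the route support
`FlatteningWitness` (`M(n,r) ≤ n·r`, stmt-4960) gives `|Σ S·T|² ≤ n r·Σ‖S‖² ≤ (n³ + r − U)·Σ‖S‖² ≤ (n³ + r − R̲)·Σ‖S‖²`
for every `S` of rank `≤ r` — the dossier's remark "implied by flattening for `r ≤ (n³ − R̲)/(n − 1)`", made
unconditional by replacing the unknown `R̲` with any certified upper bound `U`. [folklore] -/
theorem law_of_flattening_regime {n r U : ℕ} (hU : algBorderRank (matMulTensor ℂ n n n) ≤ U)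
    (h : r * n + U ≤ n ^ 3 + r) (S : P n → P n → P n → ℂ) (hS : tensorRank S ≤ r) :
    ‖∑ a, ∑ b, ∑ c, S a b c * matMulTensor ℂ n n n a b c‖ ^ 2 ≤
      ((n : ℝ) ^ 3 + (r : ℝ) - (algBorderRank (matMulTensor ℂ n n n) : ℝ)) *
        ∑ a, ∑ b, ∑ c, ‖S a b c‖ ^ 2 := by
  have hF := flatteningWitness_proof
  unfold Summit.MatrixMultiplication.MatrixMultiplication.Theses.FidelityWitnesses.FlatteningWitness at hF
  have h1 : ‖∑ a, ∑ b, ∑ c, S a b c * matMulTensor ℂ n n n a b c‖ ^ 2 ≤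
      (n : ℝ) * (r : ℝ) * ∑ a, ∑ b, ∑ c, ‖S a b c‖ ^ 2 := hF n r S hS
  have h2 : (n : ℝ) * (r : ℝ) ≤ (n : ℝ) ^ 3 + (r : ℝ) - (algBorderRank (matMulTensor ℂ n n n) : ℝ) := by
    have hU' : (algBorderRank (matMulTensor ℂ n n n) : ℝ) ≤ U := by exact_mod_cast hU
    have h' : (r : ℝ) * n + U ≤ (n : ℝ) ^ 3 + r := by exact_mod_cast h
    linarith
  exact h1.trans (mul_le_mul_of_nonneg_right h2 (normSq_nonneg S))

/-! ## `n = 3`: the law holds off the window `4 ≤ r ≤ 19` -/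

/-- `n = 3`, low end: for `r ≤ 3` the law `|Σ S·⟨3,3,3⟩|² ≤ (27 + r − R̲)·Σ‖S‖²` holds for every `S` of rank
`≤ r`, by the flattening regime with Smirnov's certificate `R̲(⟨3,3,3⟩) ≤ 20` (`3r + 20 ≤ 27 + r ⟺ r ≤ 3`).
[cite: Smirnov2013] -/
theorem lawAtThree_low {r : ℕ} (hr : r ≤ 3) (S : P 3 → P 3 → P 3 → ℂ) (hS : tensorRank S ≤ r) :
    ‖∑ a, ∑ b, ∑ c, S a b c * matMulTensor ℂ 3 3 3 a b c‖ ^ 2 ≤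
      (((3 : ℕ) : ℝ) ^ 3 + (r : ℝ) - (algBorderRank (matMulTensor ℂ 3 3 3) : ℝ)) *
        ∑ a, ∑ b, ∑ c, ‖S a b c‖ ^ 2 :=
  law_of_flattening_regime (Smirnov2013_algBorderRank_matMulTensor_three_le ℂ)
    (by rw [show (3 : ℕ) ^ 3 = 27 from rfl]; omega) S hS

/-- `n = 3`, high end: for `20 ≤ r` the law holds for every `S`, by the high regime with
`R̲(⟨3,3,3⟩) ≤ 20 ≤ r`. [cite: Smirnov2013] -/
theorem lawAtThree_high {r : ℕ} (hr : 20 ≤ r) (S : P 3 → P 3 → P 3 → ℂ) :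
    ‖∑ a, ∑ b, ∑ c, S a b c * matMulTensor ℂ 3 3 3 a b c‖ ^ 2 ≤
      (((3 : ℕ) : ℝ) ^ 3 + (r : ℝ) - (algBorderRank (matMulTensor ℂ 3 3 3) : ℝ)) *
        ∑ a, ∑ b, ∑ c, ‖S a b c‖ ^ 2 :=
  law_of_borderRank_le ((Smirnov2013_algBorderRank_matMulTensor_three_le ℂ).trans hr) S

/-- **`n = 3` off the window**: the `n = 3` instance of `LinearDefectLaw` holds unconditionally at every
`r ∉ [4, 19]`; the open content at `n = 3` is the window `4 ≤ r ≤ 19` (where it reads `M(3,r) ≤ 27 + r − R̲`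
with `R̲(⟨3,3,3⟩) ∈ [15, 20]` certified in the tree, `[17, 20]` in the literature). [cite: Smirnov2013] -/
theorem lawAtThree_off_window {r : ℕ} (hr : r ≤ 3 ∨ 20 ≤ r) (S : P 3 → P 3 → P 3 → ℂ)
    (hS : tensorRank S ≤ r) :
    ‖∑ a, ∑ b, ∑ c, S a b c * matMulTensor ℂ 3 3 3 a b c‖ ^ 2 ≤
      (((3 : ℕ) : ℝ) ^ 3 + (r : ℝ) - (algBorderRank (matMulTensor ℂ 3 3 3) : ℝ)) *
        ∑ a, ∑ b, ∑ c, ‖S a b c‖ ^ 2 := by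
  rcases hr with hr | hr
  · exact lawAtThree_low hr S hS
  · exact lawAtThree_high hr S

/-! ## `n = 4`: the law holds off the window `6 ≤ r ≤ 48` -/

/-- The certified upper bound `R̲(⟨4,4,4⟩) ≤ 49`: Kronecker square of `R̲(⟨2,2,2⟩) ≤ 7` (Strassen) via the
submultiplicativity `algBorderRank_matMulTensor_mul_le`. [cite: Strassen1969] -/
theorem algBorderRank_matMulTensor_four_le : algBorderRank (matMulTensor ℂ 4 4 4) ≤ 49 := by
  have h := algBorderRank_matMulTensor_mul_le ℂ 2 2 2 2 2 2
  have h7 := algBorderRank_matMulTensor_two_le_seven ℂ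
  have h49 : algBorderRank (matMulTensor ℂ 2 2 2) * algBorderRank (matMulTensor ℂ 2 2 2) ≤ 49 :=
    (Nat.mul_le_mul h7 h7).trans (le_of_eq (by norm_num))
  exact h.trans h49

/-- **`n = 4` off the window**: the `n = 4` instance of `LinearDefectLaw` holds unconditionally for
`r ≤ 5` (flattening regime: `4r + 49 ≤ 64 + r`) and for `49 ≤ r` (high regime). [cite: Strassen1969] -/
theorem lawAtFour_off_window {r : ℕ} (hr : r ≤ 5 ∨ 49 ≤ r) (S : P 4 → P 4 → P 4 → ℂ)
    (hS : tensorRank S ≤ r) :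
    ‖∑ a, ∑ b, ∑ c, S a b c * matMulTensor ℂ 4 4 4 a b c‖ ^ 2 ≤
      (((4 : ℕ) : ℝ) ^ 3 + (r : ℝ) - (algBorderRank (matMulTensor ℂ 4 4 4) : ℝ)) *
        ∑ a, ∑ b, ∑ c, ‖S a b c‖ ^ 2 := by
  rcases hr with hr | hr
  · exact law_of_flattening_regime algBorderRank_matMulTensor_four_le
      (by rw [show (4 : ℕ) ^ 3 = 64 from rfl]; omega) S hS
  · exact law_of_borderRank_le (algBorderRank_matMulTensor_four_le.trans hr) S

/-! ## Registered stub -/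

/-- **Registered stub `stub_lawOffWindow`** (item stmt-MatrixMultiplication-14039): the four unconditional
regimes of `LinearDefectLaw` packaged verbatim — flattening regime for any certified `U ≥ R̲`, high regime
`R̲ ≤ r`, and the `n = 3` (`r ≤ 3 ∨ 20 ≤ r`) and `n = 4` (`r ≤ 5 ∨ 49 ≤ r`) instances. [folklore] -/
theorem stub_lawOffWindow :
    (∀ (n r U : ℕ), algBorderRank (matMulTensor ℂ n n n) ≤ U → r * n + U ≤ n ^ 3 + r →
      ∀ S : Fin n × Fin n → Fin n × Fin n → Fin n × Fin n → ℂ, tensorRank S ≤ r →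
        ‖∑ a, ∑ b, ∑ c, S a b c * matMulTensor ℂ n n n a b c‖ ^ 2 ≤
          ((n : ℝ) ^ 3 + (r : ℝ) - (algBorderRank (matMulTensor ℂ n n n) : ℝ)) *
            ∑ a, ∑ b, ∑ c, ‖S a b c‖ ^ 2) ∧
    (∀ (n r : ℕ), algBorderRank (matMulTensor ℂ n n n) ≤ r →
      ∀ S : Fin n × Fin n → Fin n × Fin n → Fin n × Fin n → ℂ,
        ‖∑ a, ∑ b, ∑ c, S a b c * matMulTensor ℂ n n n a b c‖ ^ 2 ≤
          ((n : ℝ) ^ 3 + (r : ℝ) - (algBorderRank (matMulTensor ℂ n n n) : ℝ)) *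
            ∑ a, ∑ b, ∑ c, ‖S a b c‖ ^ 2) ∧
    (∀ r : ℕ, r ≤ 3 ∨ 20 ≤ r →
      ∀ S : Fin 3 × Fin 3 → Fin 3 × Fin 3 → Fin 3 × Fin 3 → ℂ, tensorRank S ≤ r →
        ‖∑ a, ∑ b, ∑ c, S a b c * matMulTensor ℂ 3 3 3 a b c‖ ^ 2 ≤
          (((3 : ℕ) : ℝ) ^ 3 + (r : ℝ) - (algBorderRank (matMulTensor ℂ 3 3 3) : ℝ)) *
            ∑ a, ∑ b, ∑ c, ‖S a b c‖ ^ 2) ∧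
    (∀ r : ℕ, r ≤ 5 ∨ 49 ≤ r →
      ∀ S : Fin 4 × Fin 4 → Fin 4 × Fin 4 → Fin 4 × Fin 4 → ℂ, tensorRank S ≤ r →
        ‖∑ a, ∑ b, ∑ c, S a b c * matMulTensor ℂ 4 4 4 a b c‖ ^ 2 ≤
          (((4 : ℕ) : ℝ) ^ 3 + (r : ℝ) - (algBorderRank (matMulTensor ℂ 4 4 4) : ℝ)) *
            ∑ a, ∑ b, ∑ c, ‖S a b c‖ ^ 2) :=
  ⟨fun _ _ _ hU h S hS => law_of_flattening_regime hU h S hS,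
   fun _ _ hr S => law_of_borderRank_le hr S,
   fun _ hr S hS => lawAtThree_off_window hr S hS,
   fun _ hr S hS => lawAtFour_off_window hr S hS⟩

end Summit.MatrixMultiplication.MatrixMultiplication.Theorems.LinearDefectLaw.Regimes
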